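import Summits.QuantumFields.YangMills.Theorems.BalabanUVNodesN15KingModelSlicesTwoSpacingHolder
import HarnessLib

/-!
# BalabanUVNodes ∕ N15 — THE KING-MODEL RUNG, CURVED EDITION (PART Χ-d): KING 1986 PROPOSITION 3.9 (3.73)–(3.75) **AT `A = 0`, BY NAME** —
# `SlicePropagator.Prop39KingOrder (kingSlicesTwoSpacing L k n e_M M a m²)`: the two-spacing η-RATES of King's genuine slices `G^{η′}_{(j)}` vs `G^η_{(j)}`,
# `0 ≤ j ≤ k − 1`, of the `(k+n)`-level and the `k`-level `A = 0` propagators over one unit cube inhabit the lit-balaban schema in King's quantifier order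
# («0 < α < 1» first, then `C, δ₀` and «γ sufficiently small»), UNIFORMLY in `k, n ≥ 1`, the cube and the mass `0 < m² ≤ m₀²`
# (Track A, DAG node N15 = NE2; FAN-OUT v1.1 §N15 s3 «KING-MODEL RUNG … NE2's analogue DECIDED in the model»)

HONEST FRAMING.  Count-neutral (cell `pub-ymgap`, seat `pub-ymgap-dag-n15-e` g18; `--supports stmt-QuantumFields-27366 --as helper` = K3⁸
`SpineGivenEndpointR13SepCoPHV`).  TEMPLATE LITERATURE, `A = 0`: C. King's scalar U(1)-Higgs MODEL on finite tori ([King1986] Prop. 3.9 (3.73)–(3.75)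
p. 665 — PRINTED and proved there (§4, (4.42)–(4.43) p. 675); here DECIDED for the tree's objects at `A = 0`, `Ω = T_η`), NOT Bałaban's covariant objects;
NE2⁺ is NOT PRINTED for those and not proved; NOT a node discharge; nothing continuum ∕ ℝ⁴ ∕ OS ∕ mass-gap ∕ Clay.  0 `sorry`, 0 `def`; standard axioms.

ASSEMBLY ONLY: (3.73) = part Χ-b `kingSlicesTwoSpacing_ineq373` read at the rate `γ(α)` of part Χ-c `kingSlicesTwoSpacing_ineq375` ((3.75)); (3.74) is
EMPTY BY TYPE (`B = PEmpty`: the VECTOR field's contour kernels are absent in the scalar model — said, not a zero kernel); one `(C, δ₀)` by `C := C₁ + C₂`,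
`δ₀ := min δ₁ δ₂` and the monotonicity of the displays.  The family-uniform `Prop39Printed` (α INSIDE one `(C, δ₀, γ)`) is NOT claimed: the rate `γ(α) =
(1−α)∕(4(1+α))` of part Χ-c vanishes as `α ↑ 1` (lit-balaban `SlicePropagatorStatementsAt` module docstring; `King1986/MinimizerHolderDecay` `α + γ ≤ 1`).
MAIN RESULTS ★★★ `prop39PrintedAt_king_zeroField` (∀ `0 < α < 1` ∃ `C, δ₀ > 0`, `γ > 0` ∀ `k, n ≥ 1` ∀ cube ∀ `0 < m² ≤ m₀²`:
`Prop39PrintedAt α (kingSlicesTwoSpacing L k n e_M M a m²) C δ₀ γ`) and ★★★ `prop39KingOrder_king_zeroField : Prop39KingOrder (kingSlicesTwoSpacing …)`.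
Together with part Ρ-g `prop37KingOrder_king_zeroField` (Prop. 3.7 by name, both runs) and dag-n15-d's `Prop38KingOrder` inhabitant (Prop. 3.8, the
minimiser), King's §3.3 two-spacing∕slice propositions 3.7–3.9 are now ALL inhabited BY NAME at `A = 0` in the tree.
HONEST SCOPE: `A = 0`, periodic b.c., odd `L ≥ 3`, `k, n ≥ 1`, cube `2L^{e_M}`, `0 < m² ≤ m₀²`; the (2.20)∕(2.17) dictionary APPLIED as the definition of
the level-`k` kernels of slice `j` (part Ρ-e `kingSliceG`; part K proves the one-step identity `ksSlice_eq_king`; the telescoped sum (2.17) on `T_η` is not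
re-proved); the fine run's slices re-indexed `j ↦ j + n` (King's «−n ≤ j ≤ k − 1»); Prop. 3.8's fields of the `TwoSpacing` datum inert (not read by Prop. 3.9).
WHAT THE CURVED CASE ADDS (one line): Prop. 3.9 for `G_(j)(Ω, A)`, regular `A ≠ 0` (Def. 3.2), `Ω ⊊ T_η`, and the contour clause (3.74) — [King1986] §4.
Locators: [King1986] (2.17) p.653, (2.20) p.654, Prop. 3.7 p.663, p.664 (pairing), Prop. 3.9 (3.73)–(3.75) p.665, (4.42)–(4.43) p.675.
-/

noncomputable section

namespace Summit.QuantumFields.YangMills.BalabanUVNodes.N15KingModelRung.Curved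

open Real Finset Matrix
open Literature.MathematicalPhysics.QuantumFieldTheory.Balaban1983to89.B5Prop11Plancherel (Tor fine unitVec)
open Literature.MathematicalPhysics.QuantumFieldTheory.King1986.Torus (tdistT tdistT_nonneg)
open Literature.MathematicalPhysics.QuantumFieldTheory.King1986.SlicePropagator (SliceKernels TwoSpacing holderDeriv Prop39PrintedAt Prop39KingOrder)

variable {d : ℕ} (L : ℕ) [NeZero L]

omit [NeZero L] in
/-- Monotonicity of the printed displays in the constants: `Cᵢ·R·S·e^{Eᵢ} ≤ C·R·S·e^{E}` for `Cᵢ ≤ C`, `Eᵢ ≤ E`, `R, S, C ≥ 0`. [folklore] -/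
theorem display_mono {Ci C R S Ei E : ℝ} (hR : 0 ≤ R) (hS : 0 ≤ S) (hC0 : 0 ≤ C) (hC : Ci ≤ C) (hE : Ei ≤ E) :
    Ci * R * S * Real.exp Ei ≤ C * R * S * Real.exp E :=
  mul_le_mul (mul_le_mul_of_nonneg_right (mul_le_mul_of_nonneg_right hC hR) hS) (Real.exp_le_exp.mpr hE) (Real.exp_nonneg _)
    (mul_nonneg (mul_nonneg hC0 hR) hS)

/-- ★★★ **KING's PROPOSITION 3.9 AT `A = 0`, AT EACH HÖLDER EXPONENT, UNIFORMLY**: for odd `L ≥ 3`, `a > 0`, `m₀² ≥ 0` and every `0 < α < 1` there are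
`C, δ₀ > 0` and a rate `γ > 0` with `Prop39PrintedAt α (kingSlicesTwoSpacing L k n e_M M a m²) C δ₀ γ` for EVERY `k, n ≥ 1`, cube `M_ν = 2L^{e_M}` and mass
`0 < m² ≤ m₀²` ((3.73) part Χ-b at the rate of (3.75) part Χ-c; (3.74) empty by type). [cite: King1986, Prop. 3.9 (3.73)–(3.75) p.665, (4.42)–(4.43) p.675] -/
theorem prop39PrintedAt_king_zeroField (hLodd : Odd L) (hL : 2 ≤ L) {a : ℝ} (ha : 0 < a) {m0sq : ℝ} (hm0 : 0 ≤ m0sq) {α : ℝ} (hα0 : 0 < α)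
    (hα1 : α < 1) :
    ∃ C δ₀ γ : ℝ, 0 < C ∧ 0 < δ₀ ∧ 0 < γ ∧ ∀ (k n eM : ℕ) (hk : 1 ≤ k) (_hn : 1 ≤ n) (M : Fin (d + 1) → ℕ) [∀ μ, NeZero (M μ)]
      (hM : ∀ μ, M μ = 2 * L ^ eM) (msq : ℝ), 0 < msq → msq ≤ m0sq → Prop39PrintedAt α (kingSlicesTwoSpacing L k n eM M hM hk a msq) C δ₀ γ := by
  obtain ⟨C₂, δ₂, γ, hC₂, hδ₂, hγ0, hγ1, H₂⟩ := kingSlicesTwoSpacing_ineq375 (d := d) L hLodd hL ha hm0 hα0 hα1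
  obtain ⟨C₁, δ₁, hC₁, hδ₁, H₁⟩ := kingSlicesTwoSpacing_ineq373 (d := d) L hLodd hL ha hm0 hγ0 hγ1
  set C : ℝ := C₁ + C₂ with hCdef
  set δ₀ : ℝ := min δ₁ δ₂ with hδdef
  have hC : 0 < C := by positivity
  have hδ₀ : 0 < δ₀ := lt_min hδ₁ hδ₂
  have hc1 : C₁ ≤ C := by rw [hCdef]; linarith
  have hc2 : C₂ ≤ C := by rw [hCdef]; linarith
  have hd1 : δ₀ ≤ δ₁ := min_le_left _ _
  have hd2 : δ₀ ≤ δ₂ := min_le_right _ _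
  refine ⟨C, δ₀, γ, hC, hδ₀, hγ0, ?_⟩
  intro k n eM hk hn M _ hM msq hmsq hcap j hj
  have hL0 : (0 : ℝ) < L := by exact_mod_cast Nat.pos_of_ne_zero (NeZero.ne L)
  -- nonnegativity of the display's factors
  have hR : 0 ≤ ((kingSlicesTwoSpacing L k n eM M hM hk a msq).lo.L : ℝ) ^ (-(γ * (kingSlicesTwoSpacing L k n eM M hM hk a msq).lo.k)) :=
    Real.rpow_nonneg (Nat.cast_nonneg _) _
  have hsl : 0 < (kingSlicesTwoSpacing L k n eM M hM hk a msq).lo.slice j :=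
    (kingSlicesTwoSpacing L k n eM M hM hk a msq).lo.slice_pos (by rw [kingSlicesTwoSpacing_loL]; exact Nat.pos_of_ne_zero (NeZero.ne L)) j
  have hdist : ∀ u v, 0 ≤ (kingSlicesTwoSpacing L k n eM M hM hk a msq).lo.dist u v := fun u v => by
    rw [kingSlicesTwoSpacing_lodist]; exact div_nonneg (tdistT_nonneg _ _ _) (pow_pos hL0 _).le
  refine ⟨fun x' y' => ?_, fun _ b' => (show PEmpty from b').elim, fun x' y' z' hxy hxy' => ?_⟩
  · obtain ⟨h1, h2⟩ := H₁ k n eM hk hn M hM msq hmsq hcap j hj x' y'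
    have hW : ∀ {δi : ℝ}, δ₀ ≤ δi →
        -(δi * ((kingSlicesTwoSpacing L k n eM M hM hk a msq).lo.slice j)⁻¹
            * (kingSlicesTwoSpacing L k n eM M hM hk a msq).lo.dist ((kingSlicesTwoSpacing L k n eM M hM hk a msq).pt x')
                ((kingSlicesTwoSpacing L k n eM M hM hk a msq).pt y'))
          ≤ -(δ₀ * ((kingSlicesTwoSpacing L k n eM M hM hk a msq).lo.slice j)⁻¹
            * (kingSlicesTwoSpacing L k n eM M hM hk a msq).lo.dist ((kingSlicesTwoSpacing L k n eM M hM hk a msq).pt x')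
                ((kingSlicesTwoSpacing L k n eM M hM hk a msq).pt y')) := by
      intro δi hδi
      have := mul_le_mul_of_nonneg_right (mul_le_mul_of_nonneg_right hδi (inv_nonneg.mpr hsl.le))
        (hdist ((kingSlicesTwoSpacing L k n eM M hM hk a msq).pt x') ((kingSlicesTwoSpacing L k n eM M hM hk a msq).pt y'))
      linarith
    exact ⟨h1.trans (display_mono hR (Real.rpow_nonneg hsl.le _) hC.le hc1 (hW hd1)),
      fun μ => (h2 μ).trans (display_mono hR (Real.rpow_nonneg hsl.le _) hC.le hc1 (hW hd1))⟩
  · obtain ⟨h1, h2⟩ := H₂ k n eM hk hn M hM msq hmsq hcap j hj x' y' z' hxy hxy'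
    have hW : ∀ {δi : ℝ}, δ₀ ≤ δi →
        -(δi * min ((kingSlicesTwoSpacing L k n eM M hM hk a msq).lo.dist ((kingSlicesTwoSpacing L k n eM M hM hk a msq).pt x')
              ((kingSlicesTwoSpacing L k n eM M hM hk a msq).pt z'))
            ((kingSlicesTwoSpacing L k n eM M hM hk a msq).lo.dist ((kingSlicesTwoSpacing L k n eM M hM hk a msq).pt y')
              ((kingSlicesTwoSpacing L k n eM M hM hk a msq).pt z')))
          ≤ -(δ₀ * min ((kingSlicesTwoSpacing L k n eM M hM hk a msq).lo.dist ((kingSlicesTwoSpacing L k n eM M hM hk a msq).pt x')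
              ((kingSlicesTwoSpacing L k n eM M hM hk a msq).pt z'))
            ((kingSlicesTwoSpacing L k n eM M hM hk a msq).lo.dist ((kingSlicesTwoSpacing L k n eM M hM hk a msq).pt y')
              ((kingSlicesTwoSpacing L k n eM M hM hk a msq).pt z'))) := by
      intro δi hδi
      have := mul_le_mul_of_nonneg_right hδi
        (le_min (hdist ((kingSlicesTwoSpacing L k n eM M hM hk a msq).pt x') ((kingSlicesTwoSpacing L k n eM M hM hk a msq).pt z'))
          (hdist ((kingSlicesTwoSpacing L k n eM M hM hk a msq).pt y') ((kingSlicesTwoSpacing L k n eM M hM hk a msq).pt z')))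
      linarith
    exact ⟨h1.trans (display_mono hR (Real.rpow_nonneg hsl.le _) hC.le hc2 (hW hd2)),
      fun μ => (h2 μ).trans (display_mono hR (Real.rpow_nonneg hsl.le _) hC.le hc2 (hW hd2))⟩

/-- ★★★ **KING's PROPOSITION 3.9 AT `A = 0`, BY NAME, IN KING's QUANTIFIER ORDER**: `Prop39KingOrder (kingSlicesTwoSpacing L k n e_M M a m²)` for odd `L ≥ 3`,
`a > 0`, every `k, n ≥ 1`, cube `2L^{e_M}` and mass `0 < m² ≤ m₀²` — the two-spacing η-rates (3.73)∕(3.75) of King's genuine slices of the `A = 0` propagators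
at the two spacings `η = L^{−k}`, `η′ = L^{−(k+n)}`, on the typer's schema. [cite: King1986, Prop. 3.9 (3.73)–(3.75) p.665] -/
theorem prop39KingOrder_king_zeroField (hLodd : Odd L) (hL : 2 ≤ L) {a : ℝ} (ha : 0 < a) {m0sq : ℝ} (hm0 : 0 ≤ m0sq) {k n : ℕ} (hk : 1 ≤ k)
    (hn : 1 ≤ n) (eM : ℕ) (M : Fin (d + 1) → ℕ) [∀ μ, NeZero (M μ)] (hM : ∀ μ, M μ = 2 * L ^ eM) {msq : ℝ} (hmsq : 0 < msq)
    (hcap : msq ≤ m0sq) : Prop39KingOrder (kingSlicesTwoSpacing L k n eM M hM hk a msq) := by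
  intro α hα0 hα1
  obtain ⟨C, δ₀, γ, _, _, hγ, H⟩ := prop39PrintedAt_king_zeroField (d := d) L hLodd hL ha hm0 hα0 hα1
  exact ⟨C, δ₀, γ, hγ, H k n eM hk hn M hM msq hmsq hcap⟩

end Summit.QuantumFields.YangMills.BalabanUVNodes.N15KingModelRung.Curved

end
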